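import Summits.BirchSwinnertonDyer.Rank1Residual.O6.X3KatoMemberBoundExactCount
import Literature.NumberTheory.EllipticCurves.Kato2004.HullDescentMuDefectProofs
import HarnessLib

/-!
# O6 / X4: the exact member count on rows WITHOUT Kato's (12.5.2) — the upper half up to `μ(𝐇²(T)⁰)`,
# and the IRREDUCIBLE non-surjective-tower rows of U₀ reduced to `μ(𝐇²) = 0` (Coates–Sujatha's
# Conjecture A) over the hull readings (cell `bsd-potss`, seat `kmc`, generation 7; part 14f)

HONEST FRAMING (cell `bsd-potss`, routes `KatoDescentPotSupersingular` / `KatoDescentTamePotSupersingular`,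
cruxes U₀ = `WildUpperDefectRankZero` / `TameUpperDefectRankZero`, children `WildUpperNonsurjTower` (19189)
/ `TameUpperNonsurjTower` (19202): the UPPER half on the rows with `E[p]` irreducible but `p`-adic tower
image not onto): NOTHING about Kato's objects is asserted and no Literature fact is minted; interfaces
(`KatoHullDescentDatum`, `IsHullOf`) and hypothesis schemata as in parts 12 and 14; the fine-Selmer `μ = 0`
enters through o6-r1's interface `FineMuZero` (a section variable, as in `O6.X4UpperOfFineMuZero`).
CONDITIONAL results; no item is closed; nothing is booked.

## The mathematics (memo v6 §6 / §2 E11)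

At any member `W` with a realised hull datum the rank-`0` count is EXACT (part 14, Reading M3♯):
`ord_p #Ш_an(W) = ord_p #Ш(W) + m`, `m = e(F/Λz) − e(𝐇²(T)⁰)` (Kato's `μ = p^m`). The divisibility
`ℓ_𝔮(𝐇²(T)⁰) ≤ ℓ_𝔮(F/Λz)` holds at every height-one `𝔮 ∌ p` with NO hypothesis on the Galois image
(Kato Thm. 12.5 (3); the exception (12.5.1) needs a potentially multiplicative `p`, Remark 12.7); only
`𝔮 = (p)` uses (12.5.2) (Thm. 12.5 (4)) or reducibility (Wuthrich Lemma 14). Since the `Γ`-Euler exponent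
weighs `(p)` with `v_p(q_{(p)}(0)) = 1` (`Kato2004.eulerExp_le_add_muInvariant_of_lengthAt_le_off_p`),
**`m ≥ −μ(𝐇²(T)⁰)`**, i.e. **`ord_p #Ш(W) ≤ ord_p #Ш_an(W) + μ(𝐇²(T)⁰)`** at every realised member, any
image: the "uncontrolled index error" of the tower-non-surjective rows is ONE named quantity, the
`μ`-invariant of `𝐇²(T)⁰`, which vanishes under Coates–Sujatha's Conjecture A for `(E, p)` (`Y(E/ℚ(μ_{p^∞}))`
finitely generated over `ℤ_p`; `Y` = kernel of `𝐇²(T) → ⊕_v 𝐇²_v(T)` by global duality, the local terms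
being `ℤ_p`-finitely generated at a potentially good `p`). On rows with `E[p]` irreducible every stable
lattice is `p^n T_pE` (tree `Kato2004.exists_galoisStable_rationalTateSubmodule_eq_range_smul_subtype`), so
the hull datum is realised at `W` ITSELF and no isogeny transport is needed.

## Contents
* §1 on the datum: `HullDivisibilityOffP` (12.5 (3) shape), `muH2 := μ(H2)`, `neg_muH2_le_muExp`,
  `hullDivisibility_of_offP_of_muH2_eq_zero`.
* §2 readings: `KatoHull.DivisibilityOffPReading` (Thm. 12.5 (3), image-free), `KatoHull.RealizableOfIrr`
  (hull datum at `W` itself when `W[p]` is irreducible), `KatoHull.MuH2ZeroReading IsHullOf FineMuZero`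
  (Conj A ⇒ `μ(𝐇²(T)⁰) = 0`).
* §3 `KatoHull.sha_le_shaAn_add_muH2` (**the defect is `μ(𝐇²)`**), `KatoHull.missingUpperBoundAt_of_muH2_eq_zero`,
  `O6.irrUpper_of_hullReadings_of_fineMuZero` (the upper half on EVERY irreducible additive potentially
  good `r_an = 0` row with `FineMuZero`, any tower image — the shape of the U₀ children 19189 / 19202 plus
  Conj A), `O6.x4UpperOfFineMuZero_of_hullReadings` (o6-r1 GEN 21's export node (Kμ-K)
  `O6.X4UpperOfFineMuZero FineMuZero` over the hull readings).

References: [Kato2004Asterisque] Thm. 12.5 (3)–(4), Thm. 12.6, Remark 12.7 (p. 222), Lemma 14.7 (p. 238),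
§14.14 and Lemma 14.15 (pp. 243–244), Prop. 14.16 (2) (p. 244); [CoatesSujatha2005] Conjecture A, Thm. 3.4;
[Wuthrich2014] Lemma 14 and proof of Prop. 15 (p. 396); [Miller2011LMS] Def. 1.1.
-/

set_option autoImplicit false

noncomputable section

open scoped Classical

open WeierstrassCurve Literature.NumberTheory.EllipticCurves
  Literature.NumberTheory.EllipticCurves.ModularForms
  Literature.NumberTheory.EllipticCurves.Rank1Residual
  Literature.NumberTheory.EllipticCurves.Rank1Residual.Typed
  Literature.NumberTheory.EllipticCurves.IwasawaAlgebra

namespace Summit.BirchSwinnertonDyer.Rank1Residual.Additive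

/-! ## §1 On the datum: divisibility off `(p)` and the `μ`-invariant of `H2` -/

namespace KatoHullDescentDatum

variable {p : ℕ} [Fact p.Prime] (D : KatoHullDescentDatum p)

/-- **The divisibility for the hull OFF `(p)`**: `ℓ_𝔮(𝐇²(T)⁰) ≤ ℓ_𝔮(F/Λz)` at every height-one prime
`𝔮 ≠ (p)` — the shape of Kato's Thm. 12.5 (3) (rational coefficients, no image hypothesis; `𝐇²_loc = 0` at a
potentially good `p`, Remark 12.7). A predicate on the datum; nothing asserted.
[cite: Kato2004Asterisque, Thm. 12.5 (3) and Remark 12.7 (p. 222)] -/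
def HullDivisibilityOffP : Prop :=
  ∀ 𝔮 : PrimeSpectrum (IwasawaAlgebra p), 𝔮.asIdeal.height = 1 → 𝔮.asIdeal ≠ augIdealP p →
    Module.lengthAt (IwasawaAlgebra p) D.H2 𝔮 ≤
      Module.lengthAt (IwasawaAlgebra p) (D.F ⧸ (IwasawaAlgebra p) ∙ D.z) 𝔮

/-- **`μ(𝐇²(T)⁰)`**, the `μ`-invariant of the torsion module `H2` of the datum (local length at `(p)`).
[cite: Kato2004Asterisque, Thm. 12.4 (1) (p. 221)] [cite: Washington1997, §13.2] -/
def muH2 : ℕ := muInvariant p D.H2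

/-- **`m ≥ −μ(𝐇²(T)⁰)` under the divisibility off `(p)`** (`Kato2004.padicValNat_natCard_coinvariants_add_le_index_add_muInvariant_of_hull`).
[cite: Kato2004Asterisque, Thm. 12.5 (3) (p. 222), §14.14 and Lemma 14.15 (pp. 243–244)] -/
theorem neg_muH2_le_muExp (hoff : D.HullDivisibilityOffP) (hfin : Finite (coinvariants p D.H2))
    (hne : D.yIndex ≠ 0) : -(D.muH2 : ℤ) ≤ D.muExp := by
  have h := Kato2004.padicValNat_natCard_coinvariants_add_le_index_add_muInvariant_of_hull D.j
    D.j_injective D.finite_coker D.z D.z_ne_zero D.isTorsion_quotient D.isTorsion_H2 hoff D.y D.e D.j_y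
    D.ι D.π D.ι_injective D.π_surjective D.exact_ι_π hfin hne
  unfold muExp muH2 yIndex h2Card
  have h' : (D.e : ℤ) + (padicValNat p (Nat.card (coinvariants p D.H2)) : ℤ) ≤
      (padicValNat p (Nat.card (D.A ⧸ (IwasawaAlgebra p) ∙ D.ι (Submodule.Quotient.mk D.y))) : ℤ) +
        (muInvariant p D.H2 : ℤ) := by
    exact_mod_cast h
  linarith

/-- **`μ(𝐇²(T)⁰) = 0` and the divisibility off `(p)` give the full divisibility for the hull** (at `(p)`:
`0 ≤ ℓ_{(p)}(F/Λz)`). [cite: Kato2004Asterisque, Thm. 12.5 (3)–(4) (p. 222)] [cite: Wuthrich2014, Lemma 14 (p. 396)] -/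
theorem hullDivisibility_of_offP_of_muH2_eq_zero (hoff : D.HullDivisibilityOffP) (h0 : D.muH2 = 0) :
    D.HullDivisibility := by
  intro 𝔮 h𝔮
  by_cases hq : 𝔮.asIdeal = augIdealP p
  · have hμ : (Module.lengthAt (IwasawaAlgebra p) D.H2 𝔮).toNat = 0 := by
      rw [← muInvariant_eq_toNat_lengthAt p D.H2 𝔮 hq]; exact h0
    have hfin : Module.lengthAt (IwasawaAlgebra p) D.H2 𝔮 ≠ ⊤ :=
      IwasawaAlgebra.lengthAt_ne_top_of_isTorsion D.H2 D.isTorsion_H2 𝔮 (le_of_eq h𝔮)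
    have h0' : Module.lengthAt (IwasawaAlgebra p) D.H2 𝔮 = 0 := by
      rw [← ENat.coe_toNat hfin, hμ]; rfl
    rw [h0']
    exact bot_le
  · exact hoff 𝔮 h𝔮 hq

end KatoHullDescentDatum

/-! ## §2 The readings (hypothesis schemata; nothing asserted) -/

namespace KatoHull

section Readings

variable (IsHullOf : ∀ (W : WeierstrassCurve ℚ) [W.IsElliptic] [W.IsGloballyMinimal] (p : ℕ)
  [Fact p.Prime], KatoHullDescentDatum p → Prop)
variable (FineMuZero : ∀ (W : WeierstrassCurve ℚ) [W.IsElliptic], ℕ → Prop)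

/-- **READING M2♭ — the divisibility for the hull OFF `(p)`, on EVERY additive potentially good row
(any image).** For a realised hull datum of a globally minimal `W` at `p ≠ 2` additive potentially good:
`ℓ_𝔮(𝐇²(T)⁰) ≤ ℓ_𝔮(F/Λz)` at every height-one `𝔮 ∌ p` — Kato's Thm. 12.5 (3) (rational coefficients:
`F_𝔮 = 𝐇¹(V)⁰_𝔮`, `Z(f)⁰_𝔮 = Λ_𝔮 z`; the local term `𝐇²_loc(V)_𝔮` vanishes since (12.5.1) fails at a
potentially good `p`, Remark 12.7), which carries NO hypothesis on the image of `ρ_{E,p}`. = part 12's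
Reading M2 minus its `(p)`-part. Hypothesis schema; nothing asserted.
[cite: Kato2004Asterisque, Thm. 12.5 (3), (12.5.1) and Remark 12.7 (p. 222), Thm. 13.4 (3) (p. 226)] -/
def DivisibilityOffPReading : Prop :=
  ∀ (W : WeierstrassCurve ℚ) [W.IsElliptic] [W.IsGloballyMinimal] (p : ℕ) [Fact p.Prime]
    (D : KatoHullDescentDatum p),
    p ≠ 2 → Addv W p → 0 ≤ padicValRat p W.j → IsHullOf W p D → D.HullDivisibilityOffP

/-- **READING M1-irr — on rows with `W[p]` IRREDUCIBLE the hull datum is realised at `W` itself.** Every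
Galois-stable `ℤ_p`-lattice of `V_pW` is `p^n T_pW` (residual irreducibility; tree theorem
`Kato2004.exists_galoisStable_rationalTateSubmodule_eq_range_smul_subtype`, Kato's Lemma 14.7 being the
`SL₂ ⊂ image` version), so Kato's lattice `V_{ℤ_p}(f)(1)` is `T_pW` up to scaling and his §14.14 data
with the zeta element in the hull (Thm. 12.4, 12.6 + 13.14, (14.14.1)) form a `KatoHullDescentDatum p` of `W`.
Hypothesis schema; nothing asserted.
[cite: Kato2004Asterisque, Thm. 12.4 (p. 221), Thm. 12.6 (p. 222), 13.14 (p. 234), Lemma 14.7 (p. 238), §14.14 (p. 243)] -/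
def RealizableOfIrr : Prop :=
  ∀ (W : WeierstrassCurve ℚ) [W.IsElliptic] [W.IsGloballyMinimal] (p : ℕ) [Fact p.Prime],
    p ≠ 2 → Addv W p → 0 ≤ padicValRat p W.j → W.HasIrreducibleModPGaloisRep p →
    ∃ D : KatoHullDescentDatum p, IsHullOf W p D

/-- **READING Mμ — Coates–Sujatha's Conjecture A for `(E,p)` kills `μ(𝐇²(T)⁰)`.** For a realised hull
datum of `W` at `p`: if the dual `Y(E/ℚ(μ_{p^∞}))` of the fine Selmer group is finitely generated over `ℤ_p`
(interface `FineMuZero W p`, o6-r1's binding) then `μ(𝐇²(T)⁰) = 0` — `Y(E)` is the kernel of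
`𝐇²(T) → ⊕_{v ∈ Σ} 𝐇²_v(T)` by global duality (Wuthrich 2014 p. 396), and the local terms are finitely
generated over `ℤ_p` (finitely many places of `ℚ(ζ_{p^∞})` above each `ℓ ≠ p`; `E(ℚ_p(μ_{p^∞}))[p^∞]` finite
at a potentially good `p`), so `μ(𝐇²(T)) = μ(Y(E)) = 0`, and the `Δ`-trivial component inherits it.
Hypothesis schema; nothing asserted.
[cite: CoatesSujatha2005, Conjecture A and Thm. 3.4] [cite: Wuthrich2014, proof of Prop. 15 (p. 396)] [cite: Kato2004Asterisque, Thm. 12.4 (1) (p. 221)] -/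
def MuH2ZeroReading : Prop :=
  ∀ (W : WeierstrassCurve ℚ) [W.IsElliptic] [W.IsGloballyMinimal] (p : ℕ) [Fact p.Prime]
    (D : KatoHullDescentDatum p), IsHullOf W p D → FineMuZero W p → D.muH2 = 0

end Readings

end KatoHull

end Summit.BirchSwinnertonDyer.Rank1Residual.Additive

/-! ## §3 Consequences -/

namespace Summit.BirchSwinnertonDyer.Rank1Residual

open Additive

variable {IsHullOf : ∀ (W : WeierstrassCurve ℚ) [W.IsElliptic] [W.IsGloballyMinimal] (p : ℕ)
  [Fact p.Prime], KatoHullDescentDatum p → Prop}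
variable {FineMuZero : ∀ (W : WeierstrassCurve ℚ) [W.IsElliptic], ℕ → Prop}

/-- **THE DEFECT OF THE UPPER HALF IS `μ(𝐇²(T)⁰)` — at every realised member, any image.** Reading M3♯
(the exact count) and the divisibility off `(p)` at the datum give `#Ш_an(W) = q' ∈ ℚ` with
**`ord_p #Ш(W) ≤ ord_p #Ш_an(W) + μ(𝐇²(T)⁰)`** in analytic rank `0`. The "index error" of Kato's bound
on the rows without (12.5.2) is this one named quantity. Conditional over displayed readings; nothing
asserted. [cite: Kato2004Asterisque, Thm. 12.5 (3) (p. 222), Prop. 14.16 (2) (p. 244)] [cite: CoatesSujatha2005, Conjecture A] -/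
theorem KatoHull.sha_le_shaAn_add_muH2 (hC : KatoHull.ExactCountReading IsHullOf)
    (hGZK : rank_eq_analyticRank_of_analyticRank_le_one) (hmod : hasEntireLFunction_rat)
    {W : WeierstrassCurve ℚ} [W.IsElliptic] [W.IsGloballyMinimal] {p : ℕ} [Fact p.Prime]
    {D : KatoHullDescentDatum p} (hp : p ≠ 2) (hadd : Addv W p) (hj : 0 ≤ padicValRat p W.j)
    (hr : W.analyticRank = 0) (hDof : IsHullOf W p D) (hoff : D.HullDivisibilityOffP) :
    ∃ q' : ℚ, shaAn W = (q' : ℂ) ∧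
      (padicValNat p W.shaOrder : ℤ) ≤ padicValRat p q' + D.muH2 := by
  obtain ⟨hfin2, hne, q', hq', hv⟩ := KatoHull.exists_shaAn_eq_of_reading hC hGZK hmod hp hadd hj hr
    hDof
  have hm : -(D.muH2 : ℤ) ≤ D.muExp := D.neg_muH2_le_muExp hoff hfin2 hne
  exact ⟨q', hq', by rw [hv]; linarith⟩

/-- **The upper half at a realised member with `μ(𝐇²(T)⁰) = 0`** (any image): Reading M3♯, the divisibility
off `(p)` and `μ(H2) = 0` give `MissingUpperBoundAt W p`. Conditional; nothing asserted.
[cite: Kato2004Asterisque, Thm. 12.5 (3)–(4) (p. 222), Prop. 14.16 (2) (p. 244)] [cite: CoatesSujatha2005, Conjecture A] -/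
theorem KatoHull.missingUpperBoundAt_of_muH2_eq_zero (hC : KatoHull.ExactCountReading IsHullOf)
    (hGZK : rank_eq_analyticRank_of_analyticRank_le_one) (hmod : hasEntireLFunction_rat)
    {W : WeierstrassCurve ℚ} [W.IsElliptic] [W.IsGloballyMinimal] {p : ℕ} [Fact p.Prime]
    {D : KatoHullDescentDatum p} (hp : p ≠ 2) (hadd : Addv W p) (hj : 0 ≤ padicValRat p W.j)
    (hr : W.analyticRank = 0) (hDof : IsHullOf W p D) (hoff : D.HullDivisibilityOffP)
    (h0 : D.muH2 = 0) : MissingUpperBoundAt W p :=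
  KatoHull.missingUpperBoundAt_of_exactCount hC hGZK hmod hp hadd hj hr hDof
    (D.hullDivisibility_of_offP_of_muH2_eq_zero hoff h0)

/-- **THE UPPER HALF ON EVERY IRREDUCIBLE ADDITIVE POTENTIALLY GOOD ROW OF ANALYTIC RANK `0` WITH
`μ(Y(E)) = 0` — ANY TOWER IMAGE** (the shape of the U₀ children `WildUpperNonsurjTower` /
`TameUpperNonsurjTower` with Coates–Sujatha's Conjecture A as the one extra input): over Reading M1-irr
(datum at `W` itself), Reading M2♭ (divisibility off `(p)`, image-free), Reading Mμ (Conj A ⇒ `μ(H2) = 0`),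
Reading M3♯ (exact count), GZK and modularity. Conditional over displayed readings; nothing asserted.
[cite: Kato2004Asterisque, Thm. 12.5 (3), Thm. 12.6 (p. 222), Lemma 14.7 (p. 238), Prop. 14.16 (2) (p. 244)]
[cite: CoatesSujatha2005, Conjecture A] -/
theorem O6.irrUpper_of_hullReadings_of_fineMuZero (hRi : KatoHull.RealizableOfIrr IsHullOf)
    (hoff : KatoHull.DivisibilityOffPReading IsHullOf)
    (hμ : KatoHull.MuH2ZeroReading IsHullOf FineMuZero) (hC : KatoHull.ExactCountReading IsHullOf)
    (hGZK : rank_eq_analyticRank_of_analyticRank_le_one) (hmod : hasEntireLFunction_rat)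
    (W : WeierstrassCurve ℚ) [W.IsElliptic] [W.IsGloballyMinimal] (p : ℕ) [Fact p.Prime]
    (hp : p ≠ 2) (hng : ¬ W.HasGoodReductionAtPrime p) (hnm : ¬ W.HasMultiplicativeReductionAtPrime p)
    (hj : 0 ≤ padicValRat p W.j) (hirr : W.HasIrreducibleModPGaloisRep p) (hfine : FineMuZero W p)
    (hr : W.analyticRank = 0) : MissingUpperBoundAt W p := by
  obtain ⟨D, hDof⟩ := hRi W p hp ⟨hng, hnm⟩ hj hirr
  exact KatoHull.missingUpperBoundAt_of_muH2_eq_zero hC hGZK hmod hp ⟨hng, hnm⟩ hj hr hDof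
    (hoff W p D hp ⟨hng, hnm⟩ hj hDof) (hμ W p D hDof hfine)

/-- **o6-r1 GEN 21's export node (Kμ-K) `O6.X4UpperOfFineMuZero FineMuZero` over the hull readings**:
Kato's A161″ conclusion `ord_p #Ш(p) + v_p(Tam) ≤ ord_p(L/Ω)` on the irreducible additive potentially good
rows with `FineMuZero`, from M1-irr, M2♭, Mμ and M3♯ (`W[p]` irreducible ⇒ `p ∤ #W(ℚ)_tors`, so `2t = 0`).
Conditional over displayed readings; nothing asserted.
[cite: Kato2004Asterisque, Thm. 12.5 (3), Thm. 12.6 (p. 222), Prop. 14.16 (2) (p. 244)] [cite: CoatesSujatha2005, Conjecture A] -/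
theorem O6.x4UpperOfFineMuZero_of_hullReadings (hRi : KatoHull.RealizableOfIrr IsHullOf)
    (hoff : KatoHull.DivisibilityOffPReading IsHullOf)
    (hμ : KatoHull.MuH2ZeroReading IsHullOf FineMuZero) (hC : KatoHull.ExactCountReading IsHullOf) :
    O6.X4UpperOfFineMuZero FineMuZero := by
  intro W _ _ p _ hp hng hnm hj hirr hfine hL hfin
  obtain ⟨D, hDof⟩ := hRi W p hp ⟨hng, hnm⟩ hj hirr
  obtain ⟨hfin2, hne, q, hq, hcount⟩ := hC W p D hp ⟨hng, hnm⟩ hj hL hfin hDof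
  have h0 : D.muH2 = 0 := hμ W p D hDof hfine
  have hdiv : D.HullDivisibility :=
    D.hullDivisibility_of_offP_of_muH2_eq_zero (hoff W p D hp ⟨hng, hnm⟩ hj hDof) h0
  have hm : 0 ≤ D.muExp := D.muExp_nonneg_of_hullDivisibility hdiv hfin2 hne
  have htors : padicValNat p W.torsionOrder = 0 := padicValNat_torsionOrder_eq_zero_of_irreducible W p hirr
  refine ⟨q, hq, ?_⟩
  unfold KatoHullDescentDatum.muExp at hm
  rw [htors] at hcount
  simp only [Nat.cast_zero, mul_zero, add_zero] at hcount
  linarith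

end Summit.BirchSwinnertonDyer.Rank1Residual

end
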